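import Literature.AlgebraicGeometry.Resolution.AlterationsMultisection
import Literature.AlgebraicGeometry.Resolution.BlowupsProduct
import Mathlib.AlgebraicGeometry.ZariskisMainTheorem
import HarnessLib

/-!
# De Jong's alteration theorem: 4.14 reduced to the multisection Lemma 4.13

Topic: `Literature/AlgebraicGeometry/Resolution`. Companion to `AlterationsMultisection.lean`,
which vendors de Jong 1996, Lemma 4.13 (`DeJong1996MultisectionLemma`) and 4.14
(`DeJong1996MultisectionReduction`) as named facts. The printed 4.14 is one paragraph:

> "4.14. Assume the pair `(X, Z)` satisfies (i)–(v) and (vi) a)–d). We apply 4.13 to the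
> morphism `f : X → Y` of (vi). This gives `H ⊂ X`. It suffices to prove the theorem for the
> pair `(X, Z ∪ H)`, see 4.9. Note that this pair also satisfies (i)–(v), (vi) a)–d) and
> (vi) e) For all geometric points `ȳ` of `Y` and any irreducible component `C` of `X_ȳ` we
> have `# sm(X/Y) ∩ C ∩ Z ≥ 3`." (p. 70)

This file PROVES `DeJong1996MultisectionReduction` from `DeJong1996MultisectionLemma`
(`DeJong1996MultisectionReduction.of_multisectionLemma`), i.e. it proves the bookkeeping
"this pair also satisfies (i)–(v), (vi) a)–d)" which the text leaves to the reader: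

* (iv) for `Z ∪ H`: the product of the two effective Cartier divisors
  (`IsEffectiveCartier.mul`, Stacks 01WU) has support `Z ∪ H`
  (`Scheme.IdealSheafData.support_mul`);
* (vi) e) for `Z ∪ H`: monotone in the subset (`DeJong1996.HasThreeSmoothPoints.union_right`);
* (vi) d) for `Z ∪ H` — **`DeJong1996.IsFiniteGenericallyEtaleOn.union`: if `f|_Z` and `f|_H`
  (reduced closed subscheme structures, 2.2) are finite and generically étale and `f` is proper,
  so is `f|_{Z ∪ H}`.** Finiteness: `(Z ∪ H)_red → Y` is proper with finite fibres (they lie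
  in the union of the fibres of `Z_red → Y` and `H_red → Y`), hence finite by Zariski's Main
  Theorem (Mathlib `IsFinite.of_isProper_of_locallyQuasiFinite`, Stacks 02LS). Generic
  étaleness: over the open `Ω₁ = X ∖ cl(H ∖ Z)` the closed immersion `Z_red ↪ (Z ∪ H)_red` is
  onto a reduced open subscheme, hence an isomorphism there
  (`isIso_inclusion_morphismRestrict`), so the étale dense open of `Z_red` transports to an
  étale open of `(Z ∪ H)_red` (`exists_etale_opens_of_inclusion`); symmetrically for `H` over
  `Ω₂ = X ∖ cl(Z ∖ H)`; and `(Z ∪ H) ∩ (Ω₁ ∪ Ω₂)` is dense in `Z ∪ H` for any closed `Z`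
  (`exists_mem_compl_closure_diff`, general topology), whence the union of the two transported
  opens is dense.

It then rewires the assemblies of `AlterationsMultisection.lean` / `AlterationsThreeBlocks.lean`
on Lemma 4.13 in place of 4.14 (`DeJong1996FibrationToSemiStablePair.of_multisectionLemma_of_toSemiStablePair`,
`DeJong1996StrongAlgClosed.of_fibration_multisectionLemma_toSemiStablePair_resolution`,
`DeJong1996Strong.of_descent_fibration_multisectionLemma_toSemiStablePair_resolution`), so that
the live named inputs of Thm. 4.1 over algebraically closed fields are 4.11–4.12, **4.13**,
4.15–4.22 and 4.23–4.28.

## Sources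

* A. J. de Jong, *Smoothness, semi-stability and alterations*, Publ. Math. IHÉS 83 (1996) 51–93:
  2.2, 2.6 (p. 55), Lemma 4.13 (pp. 69–70), 4.14 (p. 70). [DeJong1996]
* The Stacks Project, Tag 02LS (finite = proper + locally quasi-finite), Tag 01WU (sums of
  effective Cartier divisors). [StacksProject]
-/

noncomputable section

open CategoryTheory CategoryTheory.Limits AlgebraicGeometry TopologicalSpace Topology

namespace Literature.AlgebraicGeometry.Resolution

universe u

/-! ## Two more constructors of generically étale morphisms -/

namespace IsGenericallyEtale

/-- If `φ : V → W` is an open immersion with `φ ≫ g` étale, then `g` is étale on the open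
subscheme `φ(V)` of `W`. [folklore] -/
theorem etale_opensRange_ι_comp {V W S : Scheme.{u}} (φ : V ⟶ W) [IsOpenImmersion φ]
    (g : W ⟶ S) [Etale (φ ≫ g)] : Etale (φ.opensRange.ι ≫ g) := by
  rw [← Scheme.Hom.isoOpensRange_inv_comp φ, Category.assoc]
  infer_instance

/-- A morphism which is étale on each open of a family of opens with dense union is generically
étale (2.6): it is étale on the union, étaleness being local on the source. [folklore] -/
theorem of_iSup {W S : Scheme.{u}} {g : W ⟶ S} {ι : Type*} (V : ι → W.Opens)
    (hV : ∀ i, Etale ((V i).ι ≫ g)) (hd : Dense ((⨆ i, V i : W.Opens) : Set W)) :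
    IsGenericallyEtale g := by
  refine ⟨⨆ i, V i, hd, ?_⟩
  refine IsZariskiLocalAtSource.of_iSup_eq_top (P := @Etale)
    (fun i => (⨆ i, V i).ι ⁻¹ᵁ (V i)) ?_ fun i => ?_
  · apply (⨆ i, V i).ι.image_injective
    dsimp
    rw [Scheme.Hom.image_iSup, Scheme.Hom.image_top_eq_opensRange, Scheme.Opens.opensRange_ι]
    simp [Scheme.Hom.image_preimage_eq_opensRange_inf, le_iSup V]
  · have := hV i
    rw [← Category.assoc, ← Scheme.Opens.isoOfLE_hom_ι (le_iSup V i), Category.assoc]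
    infer_instance

/-- A morphism which is étale on two opens with dense union is generically étale. [folklore] -/
theorem of_sup {W S : Scheme.{u}} {g : W ⟶ S} (V₁ V₂ : W.Opens) (h₁ : Etale (V₁.ι ≫ g))
    (h₂ : Etale (V₂.ι ≫ g)) (hd : Dense ((V₁ ⊔ V₂ : W.Opens) : Set W)) :
    IsGenericallyEtale g := by
  refine of_iSup (fun b : Bool => bif b then V₁ else V₂) (fun b => ?_) ?_
  · cases b
    · exact h₂
    · exact h₁
  · rwa [iSup_bool_eq]

end IsGenericallyEtale

/-! ## Reduced closed subschemes on `Z ⊆ Z'` agree over an open where `Z' ⊆ Z` -/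

section ReducedUnion

open Scheme.IdealSheafData

/-- General topology: for `A` closed and `G` open meeting `A ∪ B`, some point of `G ∩ (A ∪ B)`
lies outside `cl(B ∖ A)` or outside `cl(A ∖ B)` — i.e. `(A ∪ B) ∖ (cl(B ∖ A) ∩ cl(A ∖ B))` is
dense in `A ∪ B`. (If every point of `G ∩ (A ∪ B)` were in both closures, a point of
`G ∩ (B ∖ A)` would lie in `cl(A ∖ B) ⊆ A`.) [folklore] -/
theorem exists_mem_compl_closure_diff {α : Type*} [TopologicalSpace α] {A B G : Set α}
    (hA : IsClosed A) (hG : IsOpen G) (hGne : (G ∩ (A ∪ B)).Nonempty) :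
    ∃ x ∈ G, x ∈ A ∪ B ∧ (x ∉ closure (B \ A) ∨ x ∉ closure (A \ B)) := by
  by_contra h
  push Not at h
  obtain ⟨x, hxG, hxAB⟩ := hGne
  obtain ⟨h1, -⟩ := h x hxG hxAB
  obtain ⟨x', hx'G, hx'B, hx'A⟩ := mem_closure_iff.mp h1 G hG hxG
  obtain ⟨-, h2⟩ := h x' hx'G (Or.inr hx'B)
  exact hx'A (closure_minimal Set.sdiff_subset hA h2)

variable {X : Scheme.{u}}

/-- The inclusion `X_Z ↪ X_{Z'}` of reduced closed subschemes is injective on points (it is a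
closed immersion, Mathlib `AlgebraicGeometry.instIsClosedImmersionInclusion`). [folklore] -/
theorem inclusion_injective {Z Z' : Closeds X} (h : vanishingIdeal Z' ≤ vanishingIdeal Z) :
    Function.Injective (inclusion h) :=
  (inclusion h).isClosedEmbedding.injective

/-- **Reduced induced structures agree where the closed subsets agree.** Let `Z ≤ Z'` be closed
subsets of a scheme `X` and `Ω ⊆ X` an open subset with `Z' ∩ Ω ⊆ Z`. Then the closed immersion
`X_Z ↪ X_{Z'}` of the reduced closed subschemes (2.2) restricts to an isomorphism over the open
`X_{Z'} ∩ Ω` of `X_{Z'}`: it is a surjective closed immersion onto a reduced scheme. [folklore] -/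
theorem isIso_inclusion_morphismRestrict {Z Z' : Closeds X}
    (h : vanishingIdeal Z' ≤ vanishingIdeal Z) (Ω : X.Opens) (hΩ : (Z' : Set X) ∩ Ω ⊆ Z) :
    IsIso (inclusion h ∣_ ((vanishingIdeal Z').subschemeι ⁻¹ᵁ Ω)) := by
  haveI : IsReduced (vanishingIdeal Z').subscheme := isReduced_subscheme_vanishingIdeal Z'
  haveI : Surjective (inclusion h ∣_ ((vanishingIdeal Z').subschemeι ⁻¹ᵁ Ω)) := by
    refine ⟨fun w => ?_⟩
    have hw : (vanishingIdeal Z').subschemeι w.1 ∈ (Z : Set X) :=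
      hΩ ⟨mem_of_subscheme_vanishingIdeal Z' w.1, w.2⟩
    have hw' : w.1 ∈ Set.range (inclusion h) := by
      rw [range_inclusion h]
      exact hw
    obtain ⟨x, hx⟩ := hw'
    refine ⟨⟨x, show inclusion h x ∈ (vanishingIdeal Z').subschemeι ⁻¹ᵁ Ω by
      rw [hx]; exact w.2⟩, Subtype.ext ?_⟩
    rw [morphismRestrict_base]
    exact hx
  exact isIso_of_isClosedImmersion_of_surjective _

/-- **Transporting an étale open along `X_Z ↪ X_{Z'}`.** In the situation of
`isIso_inclusion_morphismRestrict` (`Z ≤ Z'` closed in `X`, `Ω ⊆ X` open, `Z' ∩ Ω ⊆ Z`), let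
`f : X → Y` and let `U ⊆ X_Z` be an open subscheme with `U → X_Z → X → Y` étale. Then there is
an open subscheme `V ⊆ X_{Z'}` with `V → X_{Z'} → X → Y` étale which contains (the image of)
every point of `U` lying over `Ω`. (`V` is the image of `U ∩ Ω` under the inverse of the
isomorphism `X_Z ∩ Ω ≅ X_{Z'} ∩ Ω`.) [folklore] -/
theorem exists_etale_opens_of_inclusion {Y : Scheme.{u}} (f : X ⟶ Y) {Z Z' : Closeds X}
    (h : vanishingIdeal Z' ≤ vanishingIdeal Z) (Ω : X.Opens) (hΩ : (Z' : Set X) ∩ Ω ⊆ Z)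
    (U : (vanishingIdeal Z).subscheme.Opens)
    (hU : Etale (U.ι ≫ (vanishingIdeal Z).subschemeι ≫ f)) :
    ∃ V : (vanishingIdeal Z').subscheme.Opens,
      Etale (V.ι ≫ (vanishingIdeal Z').subschemeι ≫ f) ∧
        ∀ z ∈ U, (vanishingIdeal Z').subschemeι (inclusion h z) ∈ Ω → inclusion h z ∈ V := by
  -- the open `O = X_{Z'} ∩ Ω` over which `inclusion h` is an isomorphism
  set O : (vanishingIdeal Z').subscheme.Opens := (vanishingIdeal Z').subschemeι ⁻¹ᵁ Ω with hO
  haveI : IsIso (inclusion h ∣_ O) := isIso_inclusion_morphismRestrict h Ω hΩ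
  -- `ψ : O ⟶ X_Z`, an open immersion with `ψ ≫ inclusion h = O.ι`
  let ψ : (O : Scheme.{u}) ⟶ (vanishingIdeal Z).subscheme :=
    inv (inclusion h ∣_ O) ≫ (inclusion h ⁻¹ᵁ O).ι
  have hψ : ψ ≫ inclusion h = O.ι := by
    simp only [ψ, Category.assoc]
    rw [← morphismRestrict_ι, IsIso.inv_hom_id_assoc]
  -- the open immersion `Φ : ψ⁻¹(U) ⟶ X_{Z'}` and its range `V`
  let Φ : ((ψ ⁻¹ᵁ U : (O : Scheme.{u}).Opens) : Scheme.{u}) ⟶ (vanishingIdeal Z').subscheme :=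
    (ψ ⁻¹ᵁ U).ι ≫ O.ι
  have hΦ : Φ ≫ (vanishingIdeal Z').subschemeι ≫ f =
      (ψ ∣_ U) ≫ U.ι ≫ (vanishingIdeal Z).subschemeι ≫ f := by
    rw [morphismRestrict_ι_assoc, ← inclusion_subschemeι h]
    simp only [Φ, Category.assoc]
    rw [← Category.assoc ψ (inclusion h), hψ]
  haveI : Etale (Φ ≫ (vanishingIdeal Z').subschemeι ≫ f) := by
    rw [hΦ]
    infer_instance
  refine ⟨Φ.opensRange, IsGenericallyEtale.etale_opensRange_ι_comp Φ _, fun z hzU hzΩ => ?_⟩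
  have hzO : inclusion h z ∈ O := hzΩ
  -- the point of `O` under `inclusion h z` is sent by `ψ` to `z`
  have hψz : ψ ⟨inclusion h z, hzO⟩ = z := by
    apply inclusion_injective h
    rw [← Scheme.Hom.comp_apply, hψ]
    rfl
  exact ⟨⟨⟨inclusion h z, hzO⟩, show ψ ⟨inclusion h z, hzO⟩ ∈ U by rw [hψz]; exact hzU⟩, rfl⟩

end ReducedUnion

/-! ## (vi) d) for a union -/

namespace DeJong1996.IsFiniteGenericallyEtaleOn

open Scheme.IdealSheafData

variable {X Y : Scheme.{u}} {f : X ⟶ Y}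

/-- The core of `IsFiniteGenericallyEtaleOn.union`, for closed subsets `A`, `B` of `X` and the
reduced closed subscheme structures on `A`, `B`, `A ∪ B`: if `f` is proper and `f|_A`, `f|_B`
are finite and generically étale, so is `f|_{A ∪ B}`. [folklore] -/
theorem union_closeds [IsProper f] (A B : Closeds X)
    (hA : IsFinite ((vanishingIdeal A).subschemeι ≫ f) ∧
      IsGenericallyEtale ((vanishingIdeal A).subschemeι ≫ f))
    (hB : IsFinite ((vanishingIdeal B).subschemeι ≫ f) ∧
      IsGenericallyEtale ((vanishingIdeal B).subschemeι ≫ f)) :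
    IsFinite ((vanishingIdeal (A ⊔ B)).subschemeι ≫ f) ∧
      IsGenericallyEtale ((vanishingIdeal (A ⊔ B)).subschemeι ≫ f) := by
  haveI := hA.1
  haveI := hB.1
  have hKI : vanishingIdeal (A ⊔ B) ≤ vanishingIdeal A := vanishingIdeal_antimono le_sup_left
  have hKJ : vanishingIdeal (A ⊔ B) ≤ vanishingIdeal B := vanishingIdeal_antimono le_sup_right
  have hmemAB : ∀ w : (vanishingIdeal (A ⊔ B)).subscheme,
      (vanishingIdeal (A ⊔ B)).subschemeι w ∈ (A : Set X) ∪ B := fun w => by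
    have := mem_of_subscheme_vanishingIdeal (A ⊔ B) w
    rwa [← SetLike.mem_coe, Closeds.coe_sup] at this
  constructor
  · /- finiteness: proper with finite fibres (Zariski's Main Theorem) -/
    haveI : LocallyQuasiFinite ((vanishingIdeal (A ⊔ B)).subschemeι ≫ f) := by
      refine .of_finite_preimage_singleton _ fun y => ?_
      have hfinA := ((vanishingIdeal A).subschemeι ≫ f).finite_preimage_singleton y
      have hfinB := ((vanishingIdeal B).subschemeι ≫ f).finite_preimage_singleton y
      refine (((hfinA.image (vanishingIdeal A).subschemeι).union
        (hfinB.image (vanishingIdeal B).subschemeι)).preimage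
        (vanishingIdeal (A ⊔ B)).subschemeι.isClosedEmbedding.injective.injOn).subset ?_
      intro w hw
      have hw' : f ((vanishingIdeal (A ⊔ B)).subschemeι w) = y := by
        rw [← Scheme.Hom.comp_apply]
        exact hw
      rcases hmemAB w with hwA | hwB
      · rw [← range_subschemeι_vanishingIdeal A] at hwA
        obtain ⟨z, hz⟩ := hwA
        refine Or.inl ⟨z, ?_, hz⟩
        show ((vanishingIdeal A).subschemeι ≫ f) z ∈ ({y} : Set Y)
        rw [Scheme.Hom.comp_apply, hz]
        exact hw'
      · rw [← range_subschemeι_vanishingIdeal B] at hwB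
        obtain ⟨z, hz⟩ := hwB
        refine Or.inr ⟨z, ?_, hz⟩
        show ((vanishingIdeal B).subschemeι ≫ f) z ∈ ({y} : Set Y)
        rw [Scheme.Hom.comp_apply, hz]
        exact hw'
    exact IsFinite.of_isProper_of_locallyQuasiFinite _
  · /- generic étaleness -/
    obtain ⟨U₁, hU₁d, hU₁e⟩ := hA.2
    obtain ⟨U₂, hU₂d, hU₂e⟩ := hB.2
    let Ω₁ : X.Opens := ⟨(closure ((B : Set X) \ A))ᶜ, isClosed_closure.isOpen_compl⟩
    let Ω₂ : X.Opens := ⟨(closure ((A : Set X) \ B))ᶜ, isClosed_closure.isOpen_compl⟩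
    have hΩ₁ : ((A ⊔ B : Closeds X) : Set X) ∩ Ω₁ ⊆ A := by
      rintro x ⟨hx, hx'⟩
      rw [Closeds.coe_sup] at hx
      rcases hx with hxA | hxB
      · exact hxA
      · by_contra hxA
        exact hx' (subset_closure ⟨hxB, hxA⟩)
    have hΩ₂ : ((A ⊔ B : Closeds X) : Set X) ∩ Ω₂ ⊆ B := by
      rintro x ⟨hx, hx'⟩
      rw [Closeds.coe_sup] at hx
      rcases hx with hxA | hxB
      · by_contra hxB
        exact hx' (subset_closure ⟨hxA, hxB⟩)
      · exact hxB
    obtain ⟨V₁, hV₁e, hV₁⟩ := exists_etale_opens_of_inclusion f hKI Ω₁ hΩ₁ U₁ hU₁e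
    obtain ⟨V₂, hV₂e, hV₂⟩ := exists_etale_opens_of_inclusion f hKJ Ω₂ hΩ₂ U₂ hU₂e
    refine IsGenericallyEtale.of_sup V₁ V₂ hV₁e hV₂e ?_
    -- density of `V₁ ∪ V₂`
    rw [dense_iff_inter_open]
    rintro G hG ⟨w, hwG⟩
    obtain ⟨G', hG', rfl⟩ :=
      (vanishingIdeal (A ⊔ B)).subschemeι.isClosedEmbedding.isInducing.isOpen_iff.mp hG
    obtain ⟨x, hxG', hxAB, hx⟩ := exists_mem_compl_closure_diff (B := (B : Set X)) A.isClosed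
      hG' ⟨_, hwG, hmemAB w⟩
    rcases hx with hx₁ | hx₂
    · -- `x ∈ Ω₁`, hence `x ∈ A`: move to `X_A`, where `U₁` is dense
      have hxA : x ∈ (A : Set X) := hΩ₁ ⟨by rwa [Closeds.coe_sup], hx₁⟩
      rw [← range_subschemeι_vanishingIdeal A] at hxA
      obtain ⟨z, rfl⟩ := hxA
      obtain ⟨z', hz'G, hz'U⟩ := hU₁d.inter_open_nonempty
        ((vanishingIdeal A).subschemeι ⁻¹ᵁ (⟨G', hG'⟩ ⊓ Ω₁) : (vanishingIdeal A).subscheme.Opens)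
        (Opens.isOpen _) ⟨z, hxG', hx₁⟩
      refine ⟨inclusion hKI z', ?_, ?_⟩
      · show (vanishingIdeal (A ⊔ B)).subschemeι (inclusion hKI z') ∈ G'
        rw [subschemeι_inclusion_apply]
        exact hz'G.1
      · exact Opens.mem_sup.mpr (Or.inl (hV₁ z' hz'U (by
          rw [subschemeι_inclusion_apply]; exact hz'G.2)))
    · -- `x ∈ Ω₂`, hence `x ∈ B`: move to `X_B`, where `U₂` is dense
      have hxB : x ∈ (B : Set X) := hΩ₂ ⟨by rwa [Closeds.coe_sup], hx₂⟩
      rw [← range_subschemeι_vanishingIdeal B] at hxB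
      obtain ⟨z, rfl⟩ := hxB
      obtain ⟨z', hz'G, hz'U⟩ := hU₂d.inter_open_nonempty
        ((vanishingIdeal B).subschemeι ⁻¹ᵁ (⟨G', hG'⟩ ⊓ Ω₂) : (vanishingIdeal B).subscheme.Opens)
        (Opens.isOpen _) ⟨z, hxG', hx₂⟩
      refine ⟨inclusion hKJ z', ?_, ?_⟩
      · show (vanishingIdeal (A ⊔ B)).subschemeι (inclusion hKJ z') ∈ G'
        rw [subschemeι_inclusion_apply]
        exact hz'G.1
      · exact Opens.mem_sup.mpr (Or.inr (hV₂ z' hz'U (by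
          rw [subschemeι_inclusion_apply]; exact hz'G.2)))

/-- **(vi) d) for a union** (the bookkeeping of de Jong 1996, 4.14: "Note that this pair also
satisfies […] (vi) a)–d)" for `(X, Z ∪ H)`): if `f : X → Y` is proper and `f|_Z : Z → Y`,
`f|_H : H → Y` are finite and generically étale for the reduced closed subscheme structures on
the closures of `Z`, `H` (2.2, `IsFiniteGenericallyEtaleOn`), then so is `f|_{Z ∪ H}`.
[cite: DeJong1996, 4.14, p. 70] -/
theorem union [IsProper f] {Z H : Set X} (hZ : IsFiniteGenericallyEtaleOn f Z)
    (hH : IsFiniteGenericallyEtaleOn f H) : IsFiniteGenericallyEtaleOn f (Z ∪ H) := by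
  have key := union_closeds (f := f) ⟨closure Z, isClosed_closure⟩ ⟨closure H, isClosed_closure⟩
    hZ hH
  have e : (⟨closure (Z ∪ H), isClosed_closure⟩ : Closeds X) =
      ⟨closure Z, isClosed_closure⟩ ⊔ ⟨closure H, isClosed_closure⟩ := by
    ext1
    exact closure_union
  unfold IsFiniteGenericallyEtaleOn
  rw [e]
  exact key

end DeJong1996.IsFiniteGenericallyEtaleOn

/-! ## (iv) for a union -/

/-- **(iv) for a union** (de Jong 1996, 4.14 for `(X, Z ∪ H)`): if `Z` and `H` are supports of
effective Cartier divisors `D`, `D'` then `Z ∪ H` is the support of the effective Cartier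
divisor `D + D'` (product of the ideal sheaves, Stacks 01WU). [cite: DeJong1996, 4.14, p. 70] -/
theorem exists_isEffectiveCartier_union {X : Scheme.{u}} {Z H : Set X}
    (hZ : ∃ I : X.IdealSheafData, IsEffectiveCartier I ∧ (I.support : Set X) = Z)
    (hH : ∃ I : X.IdealSheafData, IsEffectiveCartier I ∧ (I.support : Set X) = H) :
    ∃ I : X.IdealSheafData, IsEffectiveCartier I ∧ (I.support : Set X) = Z ∪ H := by
  obtain ⟨I, hI, hIZ⟩ := hZ
  obtain ⟨J, hJ, hJH⟩ := hH
  refine ⟨I * J, IsEffectiveCartier.mul hI hJ, ?_⟩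
  rw [Scheme.IdealSheafData.support_mul, Closeds.coe_sup, hIZ, hJH]

/-! ## 4.14 from Lemma 4.13 -/

namespace DeJong1996.FibredPair

variable {k : Type u} [Field k] {X Y : Scheme.{u}} [IsIntegral Y] {f : X ⟶ Y}
  {g : Y ⟶ Spec (.of k)} {Z : Set X}

/-- The fibration `f : X → Y` of a fibred pair is proper (`X`, `Y` projective over `k`).
[folklore] -/
theorem isProper_fibration (h : FibredPair f g Z) : IsProper f := by
  haveI : IsProper (f ≫ g) := h.isProper
  haveI : IsProper g :=
    Literature.AlgebraicGeometry.Motives.IsProjectiveOver.isProper (X := Over.mk g)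
      h.isProjectiveOver_base
  exact IsProper.of_comp f g

/-- **Adjoining a finite generically étale divisor** (the bookkeeping of 4.14): if `(X, Z)` is a
fibred pair for `f` and `H ⊆ X` is the support of an effective Cartier divisor with `f|_H`
finite and generically étale, then `(X, Z ∪ H)` is a fibred pair for `f`.
[cite: DeJong1996, 4.14, p. 70] -/
theorem union (h : FibredPair f g Z) {H : Set X}
    (hH : ∃ I : X.IdealSheafData, IsEffectiveCartier I ∧ (I.support : Set X) = H)
    (hfin : IsFiniteGenericallyEtaleOn f H) : FibredPair f g (Z ∪ H) where
  isIntegral := h.isIntegral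
  isProjectiveOver := h.isProjectiveOver
  exists_isEffectiveCartier := exists_isEffectiveCartier_union h.exists_isEffectiveCartier hH
  isProjectiveOver_base := h.isProjectiveOver_base
  isCurveFibration := h.isCurveFibration
  isFiniteGenericallyEtaleOn :=
    haveI := h.isProper_fibration
    h.isFiniteGenericallyEtaleOn.union hfin

end DeJong1996.FibredPair

/-- **de Jong 1996, 4.14 from Lemma 4.13.** "We apply 4.13 to the morphism `f : X → Y` of (vi).
This gives `H ⊂ X`. […] Note that this pair [`(X, Z ∪ H)`] also satisfies (i)–(v), (vi) a)–d)
and (vi) e)": the named fact `DeJong1996MultisectionReduction` follows from the named fact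
`DeJong1996MultisectionLemma` by the bookkeeping of this file ((iv):
`exists_isEffectiveCartier_union`; (vi) d): `DeJong1996.IsFiniteGenericallyEtaleOn.union`;
(vi) e): `DeJong1996.HasThreeSmoothPoints.union_right`). Hypothesis (v) (`X` normal) is not
used. [cite: DeJong1996, 4.14, p. 70] -/
theorem DeJong1996MultisectionReduction.of_multisectionLemma
    (h13 : DeJong1996MultisectionLemma.{u}) : DeJong1996MultisectionReduction.{u} := by
  intro k _ _ X Y _ f _ g Z hP _
  haveI := hP.isIntegral
  obtain ⟨H, hHdiv, hHfin, hH3⟩ := h13 k X Y f g hP.isProjectiveOver hP.isProjectiveOver_base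
    hP.isCurveFibration.surjective hP.isCurveFibration.geometricallyConnected
    hP.isCurveFibration.topologicalKrullDim_eq_one hP.isCurveFibration.dense_preimage_smoothLocus
  exact ⟨H, hP.union hHdiv hHfin, hH3.union_right Z⟩

/-! ## The assemblies rewired on Lemma 4.13 -/

/-- **4.13–4.22 from Lemma 4.13 and 4.15–4.22** (`DeJong1996FibrationToSemiStablePair` from
`DeJong1996MultisectionLemma` and `DeJong1996MultisectionToSemiStablePair`).
[cite: DeJong1996, 4.13–4.22, pp. 69–75] -/
theorem DeJong1996FibrationToSemiStablePair.of_multisectionLemma_of_toSemiStablePair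
    (h13 : DeJong1996MultisectionLemma.{u}) (h15 : DeJong1996MultisectionToSemiStablePair.{u}) :
    DeJong1996FibrationToSemiStablePair.{u} :=
  DeJong1996FibrationToSemiStablePair.of_multisection_of_toSemiStablePair
    (DeJong1996MultisectionReduction.of_multisectionLemma h13) h15

/-- **`DeJong1996NormalProjectiveStepVI` (4.13–4.28) from Lemma 4.13, 4.15–4.22 and 4.23–4.28.**
[cite: DeJong1996, 4.13–4.28, pp. 69–76] -/
theorem DeJong1996NormalProjectiveStepVI.of_multisectionLemma_of_toSemiStablePair_of_resolution
    (h13 : DeJong1996MultisectionLemma.{u}) (h15 : DeJong1996MultisectionToSemiStablePair.{u})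
    (hres : DeJong1996SemiStablePairResolution.{u}) : DeJong1996NormalProjectiveStepVI.{u} :=
  DeJong1996NormalProjectiveStepVI.of_multisection_of_toSemiStablePair_of_resolution
    (DeJong1996MultisectionReduction.of_multisectionLemma h13) h15 hres

/-- **Thm. 4.1 with its generically-étale clause over algebraically closed fields
(`DeJong1996StrongAlgClosed`) from the four live nodes** 4.11–4.12
(`DeJong1996FibrationReduction`), Lemma 4.13 (`DeJong1996MultisectionLemma`), 4.15–4.22
(`DeJong1996MultisectionToSemiStablePair`) and 4.23–4.28 (`DeJong1996SemiStablePairResolution`).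
[cite: DeJong1996, 4.3–4.28, pp. 66–76] -/
theorem DeJong1996StrongAlgClosed.of_fibration_multisectionLemma_toSemiStablePair_resolution
    (h₁ : DeJong1996FibrationReduction.{u}) (h13 : DeJong1996MultisectionLemma.{u})
    (h15 : DeJong1996MultisectionToSemiStablePair.{u}) (hres : DeJong1996SemiStablePairResolution.{u}) :
    DeJong1996StrongAlgClosed.{u} :=
  DeJong1996StrongAlgClosed.of_fourBlocks h₁
    (DeJong1996MultisectionReduction.of_multisectionLemma h13) h15 hres

/-- **Thm. 4.1 (i)+(ii) and its last sentence** from the limit argument of 4.5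
(`DeJong1996.FiniteSubextension45`), 4.11–4.12, Lemma 4.13, 4.15–4.22 and 4.23–4.28.
[cite: DeJong1996, Thm. 4.1, p. 66] -/
theorem DeJong1996Strong.of_finiteSubextension45_fibration_multisectionLemma_toSemiStablePair_resolution
    (H : DeJong1996.FiniteSubextension45.{u}) (h₁ : DeJong1996FibrationReduction.{u})
    (h13 : DeJong1996MultisectionLemma.{u}) (h15 : DeJong1996MultisectionToSemiStablePair.{u})
    (hres : DeJong1996SemiStablePairResolution.{u}) :
    DeJong1996Strong.{u} ∧ DeJong1996StrongPerfect.{u} :=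
  DeJong1996Strong.of_finiteSubextension45_of_fourBlocks H h₁
    (DeJong1996MultisectionReduction.of_multisectionLemma h13) h15 hres

/-- Thm. 4.1 (i)+(ii) over every field from 4.5 (`DeJong1996Descent`), 4.11–4.12, Lemma 4.13,
4.15–4.22 and 4.23–4.28. [cite: DeJong1996, 4.3–4.28, pp. 66–76] -/
theorem DeJong1996Strong.of_descent_fibration_multisectionLemma_toSemiStablePair_resolution
    (h45 : DeJong1996Descent.{u}) (h₁ : DeJong1996FibrationReduction.{u})
    (h13 : DeJong1996MultisectionLemma.{u}) (h15 : DeJong1996MultisectionToSemiStablePair.{u})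
    (hres : DeJong1996SemiStablePairResolution.{u}) : DeJong1996Strong.{u} :=
  DeJong1996Strong.of_descent_of_fourBlocks h45 h₁
    (DeJong1996MultisectionReduction.of_multisectionLemma h13) h15 hres

end Literature.AlgebraicGeometry.Resolution

end
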